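import Summits.CriticalPhenomena.PercolationContinuityZ3.Theorems.PercNearOneGluingNoHeavyQuantFarSunGameLam
import Mathlib.Tactic.Linarith
import HarnessLib

/-!
# FAR beyond trees: a FAST tabulation of the delay-2 budget game (same tables, fewer operations)

builds on p205010 (kernel theorem, internal audit signed; external expert review pending)

Support file (`--supports stmt-CriticalPhenomena-4575`), seat `prim-cert-1` (gen 39); memo `prim-cert-1/FROM-prim-cert-1-g39-VERTEX-GAME.md` §7(c).

The game tables `GameSpec.gameArr` / `GameSpec.gameArrL` (…QuantFarSunGame, …GameLam) are evaluated by `native_decide` in the certificate files.  The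
reference evaluator recomputes, for every table entry and every letter, the successor states, their indices, the alphabet lookups and the range test;
for the last open case `K = 12` of layer 2 (7–8 letters, budgets up to 120) this exceeds the gate's elaboration budget.  Here the SAME tables are computed
row by row: for a fixed (state, pending letters) the successor rows and the letter data are computed once (`GameSpec.fastRow`), the inner loop over the
letters is a structural recursion reading the previous layer at precomputed offsets (`GameSpec.lettersLoop`), and budgets outside the feasible window
`[m·wmin, m·wmax]` of layer `m` are skipped (`GameSpec.wmin`, `GameSpec.wmax`; justified by `GameSpec.isSome_lookup_gameIter`).  The main theorem
**`GameSpec.fastArr_eq`** states `fastArr base NB n = gameIter NB n (tabulate NB base)` for every base layer vanishing off budget `0`; hence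
`gameArrF = gameArr`, `gameArrLF = gameArrL`, and the fast certificates `gameCertF` / `gameCertTF` EQUAL `gameCert` / `gameCertT`
(**`GameSpec.gameCertF_eq`**, **`GameSpec.gameCertTF_eq`**), so the soundness theorems `autoE_nonneg_of_gameCert` / `autoEL_ge_of_gameCertT` apply verbatim.
The threshold schedule used to STATE the `K = 12` certificates is in …QuantFarSunGameThr.  Elementary [this work]; no sorries; standard axioms.
-/

namespace Summit.CriticalPhenomena.PercolationContinuityZ3.Theorems.HairyCycle

namespace GameSpec

variable (P : GameSpec)

/-! ## Definitions -/

/-- The letter weights as an array. [this work] -/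
def wArr : Array ℕ := (P.letters.map Prod.snd).toArray

/-- The least letter weight (over the letters `0 … nL−1`; `wOf 0` if there are none). [this work] -/
def wmin : ℕ := (List.range P.nL).foldl (fun m i => min m (P.wOf i)) (P.wOf 0)

/-- The largest letter weight. [this work] -/
def wmax : ℕ := (List.range P.nL).foldl (fun m i => max m (P.wOf i)) 0

/-- Inner loop of the Bellman step over the letters `0 … j−1`, reading the previous layer `arr` at the precomputed row offsets
`(i + baseOp)·NB1` (open successor) and `(i + baseCl)·NB1` (closed successor); `ka = k_a`, `qa = q − k_a`. [this work] -/
def lettersLoop (arr : Array (Option ℤ)) (ws : Array ℕ) (NB1 baseOp baseCl : ℕ) (ka qa : ℤ) (B : ℕ) : ℕ → Option ℤ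
  | 0 => none
  | i + 1 =>
    let acc := lettersLoop arr ws NB1 baseOp baseCl ka qa B i
    let w := (ws[i]?).getD 0
    if w ≤ B then
      omin acc
        (match (arr[(i + baseOp) * NB1 + (B - w)]?).getD none, (arr[(i + baseCl) * NB1 + (B - w)]?).getD none with
          | some u, some v => some (ka * u + qa * v)
          | _, _ => none)
    else acc

/-- One row of the next layer: the entries (state `s`, pending `a`, `b`, all budgets `0 … NB`) for the row index `r` (the layout of `dIdx`
above the budget), with budgets outside `[lo, hi]` set to `none` without evaluation. [this work] -/
def fastRow (NB lo hi : ℕ) (ws : Array ℕ) (L : ℕ) (arr : Array (Option ℤ)) (r : ℕ) : Array (Option ℤ) :=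
  let b := r % L
  let r₂ := r / L
  let a := r₂ % L
  let r₃ := r₂ / L
  let Cf := r₃ % (P.Cc + 1)
  let r₄ := r₃ / (P.Cc + 1)
  let Np := r₄ % (P.C + 1)
  let r₅ := r₄ / (P.C + 1)
  let Nc := r₅ % (P.C + 1)
  let A := r₅ / (P.C + 1)
  let s : FSt := ⟨A, Nc, Np, Cf⟩
  let so := s.op P.Amax P.Cc
  let sc := s.cl P.C
  let baseOp := (b + P.sIdx so * L) * L
  let baseCl := (b + P.sIdx sc * L) * L
  let ka : ℤ := P.kOf a
  let qa : ℤ := (P.q : ℤ) - P.kOf a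
  Array.ofFn fun B : Fin (NB + 1) =>
    if B.1 < lo ∨ hi < B.1 then none else lettersLoop arr ws (NB + 1) baseOp baseCl ka qa B.1 L

/-- The next layer (`m` letters to commit), flattened in the layout of `tabulate`. [this work] -/
def fastLayer (NB m : ℕ) (ws : Array ℕ) (L wlo whi : ℕ) (arr : Array (Option ℤ)) : Array (Option ℤ) :=
  let rows : Array (Array (Option ℤ)) :=
    Array.ofFn fun r : Fin (P.nS * L * L) => P.fastRow NB (m * wlo) (m * whi) ws L arr r.1
  Array.ofFn fun i : Fin (P.tSize NB) => ((rows[i.1 / (NB + 1)]?).getD #[])[i.1 % (NB + 1)]?.getD none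

/-- **Fast game table** from a base layer: layer `n`. [this work] -/
def fastArr (base : FSt → ℕ → ℕ → ℕ → Option ℤ) (NB : ℕ) : ℕ → Array (Option ℤ)
  | 0 => P.tabulate NB base
  | m + 1 => P.fastLayer NB (m + 1) P.wArr P.nL P.wmin P.wmax (fastArr base NB m)

/-- Fast version of `gameArr`. [this work] -/
def gameArrF (NB n : ℕ) : Array (Option ℤ) := P.fastArr P.baseVal NB n

/-- Fast version of `gameArrL`. [this work] -/
def gameArrLF (lamN lamD NB n : ℕ) : Array (Option ℤ) := P.fastArr (P.baseValL lamN lamD) NB n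

/-- Fast version of the certificate check `gameCert` (same value, `gameCertF_eq`). [this work] -/
def gameCertF (NB K : ℕ) (Bs : List ℕ) : Bool :=
  let T := P.gameArrF NB (K - 2)
  Bs.all fun B => match P.startOf NB T B with
    | some v => decide (0 ≤ v)
    | none => true

/-- Fast version of the threshold certificate `gameCertT` (same value, `gameCertTF_eq`). [this work] -/
def gameCertTF (lamN lamD NB K : ℕ) (Bt : List (ℕ × ℤ)) : Bool :=
  let T := P.gameArrLF lamN lamD NB (K - 2)
  Bt.all fun bt => match P.startOf NB T bt.1 with
    | some v => decide (bt.2 ≤ v)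
    | none => true

/-! ## The letter data -/

/-- The weight array reads the weights. [this work] -/
theorem wArr_getD (i : ℕ) : (P.wArr[i]?).getD 0 = P.wOf i := by
  unfold wArr wOf
  rw [List.getElem?_toArray, List.getElem?_map, List.getD_eq_getElem?_getD]
  cases P.letters[i]? <;> rfl

/-- A running minimum never exceeds its initial value. [folklore] -/
theorem foldl_min_le_init (f : ℕ → ℕ) (l : List ℕ) (a : ℕ) : l.foldl (fun m i => min m (f i)) a ≤ a := by
  induction l generalizing a with
  | nil => simp
  | cons x l ih => exact (ih _).trans (min_le_left _ _)

/-- A running minimum is at most every listed value. [folklore] -/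
theorem foldl_min_le (f : ℕ → ℕ) (l : List ℕ) (a : ℕ) {i : ℕ} (hi : i ∈ l) : l.foldl (fun m i => min m (f i)) a ≤ f i := by
  induction l generalizing a with
  | nil => simp at hi
  | cons x l ih =>
    rw [List.foldl_cons]
    rcases List.mem_cons.1 hi with rfl | h
    · exact (foldl_min_le_init f l _).trans (min_le_right _ _)
    · exact ih _ h

/-- A running maximum is at least its initial value. [folklore] -/
theorem le_foldl_max_init (f : ℕ → ℕ) (l : List ℕ) (a : ℕ) : a ≤ l.foldl (fun m i => max m (f i)) a := by
  induction l generalizing a with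
  | nil => simp
  | cons x l ih => exact (le_max_left _ _).trans (ih _)

/-- A running maximum is at least every listed value. [folklore] -/
theorem le_foldl_max (f : ℕ → ℕ) (l : List ℕ) (a : ℕ) {i : ℕ} (hi : i ∈ l) : f i ≤ l.foldl (fun m i => max m (f i)) a := by
  induction l generalizing a with
  | nil => simp at hi
  | cons x l ih =>
    rw [List.foldl_cons]
    rcases List.mem_cons.1 hi with rfl | h
    · exact (le_max_right _ _).trans (le_foldl_max_init f l _)
    · exact ih _ h

/-- `wmin ≤ w_i`. [this work] -/
theorem wmin_le {i : ℕ} (hi : i < P.nL) : P.wmin ≤ P.wOf i :=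
  foldl_min_le P.wOf _ _ (List.mem_range.2 hi)

/-- `w_i ≤ wmax`. [this work] -/
theorem le_wmax {i : ℕ} (hi : i < P.nL) : P.wOf i ≤ P.wmax :=
  le_foldl_max P.wOf _ _ (List.mem_range.2 hi)

/-! ## The feasible budget window of a layer -/

/-- The reference Bellman step, unfolded (restated here so that the `match` of the statements below is literally this one). [this work] -/
theorem stepVal_eq (prev : FSt → ℕ → ℕ → ℕ → Option ℤ) (s : FSt) (a b B : ℕ) :
    P.stepVal prev s a b B =
      (List.range P.nL).foldl (fun acc i =>
        if P.wOf i ≤ B then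
          omin acc
            (match prev (s.op P.Amax P.Cc) b i (B - P.wOf i), prev (s.cl P.C) b i (B - P.wOf i) with
              | some u, some v => some ((P.kOf a : ℤ) * u + ((P.q : ℤ) - P.kOf a) * v)
              | _, _ => none)
        else acc) none := rfl


/-- `omin x y` is `none` only if both arguments are. [this work] -/
theorem isSome_omin {x y : Option ℤ} (h : (omin x y).isSome) : x.isSome ∨ y.isSome := by
  cases x <;> cases y <;> simp_all [omin]

/-- What the Bellman fold can return: `none` unless some admissible letter has both predecessors. [this work] -/
theorem isSome_foldl_step (prev : FSt → ℕ → ℕ → ℕ → Option ℤ) (s : FSt) (a b B : ℕ) (l : List ℕ) (init : Option ℤ)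
    (h : (l.foldl (fun acc i =>
      if P.wOf i ≤ B then
        omin acc
          (match prev (s.op P.Amax P.Cc) b i (B - P.wOf i), prev (s.cl P.C) b i (B - P.wOf i) with
            | some u, some v => some ((P.kOf a : ℤ) * u + ((P.q : ℤ) - P.kOf a) * v)
            | _, _ => none)
      else acc) init).isSome) :
    init.isSome ∨ ∃ i ∈ l, P.wOf i ≤ B ∧ (prev (s.op P.Amax P.Cc) b i (B - P.wOf i)).isSome ∧
      (prev (s.cl P.C) b i (B - P.wOf i)).isSome := by
  induction l generalizing init with
  | nil => exact Or.inl h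
  | cons x l ih =>
    rw [List.foldl_cons] at h
    rcases ih _ h with h1 | ⟨i, hil, hi⟩
    · by_cases hx : P.wOf x ≤ B
      · rw [if_pos hx] at h1
        rcases isSome_omin h1 with h2 | h2
        · exact Or.inl h2
        · refine Or.inr ⟨x, List.mem_cons_self, hx, ?_⟩
          revert h2
          cases prev (s.op P.Amax P.Cc) b x (B - P.wOf x) <;> cases prev (s.cl P.C) b x (B - P.wOf x) <;> simp
      · rw [if_neg hx] at h1
        exact Or.inl h1
    · exact Or.inr ⟨i, List.mem_cons_of_mem _ hil, hi⟩

/-- **Feasible window**: an entry of layer `m` (over a base layer vanishing off budget `0`) is `none` unless `m·wmin ≤ B ≤ m·wmax`. [this work] -/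
theorem isSome_lookup_gameIter {base : FSt → ℕ → ℕ → ℕ → Option ℤ} (hbase : ∀ s a b B, (base s a b B).isSome → B = 0) (NB : ℕ) :
    ∀ (m : ℕ) (s : FSt) (a b B : ℕ), (P.lookup NB (P.gameIter NB m (P.tabulate NB base)) s a b B).isSome →
      m * P.wmin ≤ B ∧ B ≤ m * P.wmax := by
  intro m
  induction m with
  | zero =>
    intro s a b B h
    by_cases hr : P.InRange NB s a b B
    · rw [GameSpec.gameIter, lookup_tabulate _ hr] at h
      simp [hbase _ _ _ _ h]
    · simp [GameSpec.lookup, if_neg hr] at h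
  | succ m ih =>
    intro s a b B h
    by_cases hr : P.InRange NB s a b B
    · rw [gameIter_succ, lookup_tabulate _ hr, stepVal_eq] at h
      rcases P.isSome_foldl_step _ s a b B _ none h with h0 | ⟨i, hil, hwi, h1, h2⟩
      · simp at h0
      · have hi := List.mem_range.1 hil
        have b1 := ih _ _ _ _ h1
        have hw1 := P.wmin_le hi
        have hw2 := P.le_wmax hi
        constructor
        · rw [Nat.succ_mul]; omega
        · rw [Nat.succ_mul]; omega
    · simp [GameSpec.lookup, if_neg hr] at h

/-- Outside the window the Bellman step returns `none`. [this work] -/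
theorem stepVal_eq_none {prev : FSt → ℕ → ℕ → ℕ → Option ℤ} {m : ℕ}
    (hprev : ∀ (s : FSt) (a b B : ℕ), (prev s a b B).isSome → m * P.wmin ≤ B ∧ B ≤ m * P.wmax)
    (s : FSt) (a b : ℕ) {B : ℕ} (hB : B < (m + 1) * P.wmin ∨ (m + 1) * P.wmax < B) : P.stepVal prev s a b B = none := by
  rcases hres : P.stepVal prev s a b B with _ | v
  · rfl
  · exfalso
    have h : (P.stepVal prev s a b B).isSome := by rw [hres]; rfl
    rw [stepVal_eq] at h
    rcases P.isSome_foldl_step _ s a b B _ none h with h0 | ⟨i, hil, hwi, h1, h2⟩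
    · simp at h0
    · have hi := List.mem_range.1 hil
      have b1 := hprev _ _ _ _ h1
      have hw1 := P.wmin_le hi
      have hw2 := P.le_wmax hi
      rw [Nat.succ_mul, Nat.succ_mul] at hB
      omega

/-! ## The fast row equals the reference Bellman step -/

/-- The inner loop is the reference fold, read through `lookup`. [this work] -/
theorem lettersLoop_eq (NB : ℕ) (arr : Array (Option ℤ)) {s : FSt} (hs : s.Valid P.Amax P.C P.Cc) {a b B : ℕ}
    (hb : b < P.nL) (hB : B ≤ NB) :
    ∀ j, j ≤ P.nL →
      lettersLoop arr P.wArr (NB + 1) ((b + P.sIdx (s.op P.Amax P.Cc) * P.nL) * P.nL) ((b + P.sIdx (s.cl P.C) * P.nL) * P.nL)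
          (P.kOf a) ((P.q : ℤ) - P.kOf a) B j =
        (List.range j).foldl (fun acc i =>
          if P.wOf i ≤ B then
            omin acc
              (match P.lookup NB arr (s.op P.Amax P.Cc) b i (B - P.wOf i), P.lookup NB arr (s.cl P.C) b i (B - P.wOf i) with
                | some u, some v => some ((P.kOf a : ℤ) * u + ((P.q : ℤ) - P.kOf a) * v)
                | _, _ => none)
          else acc) none := by
  intro j
  induction j with
  | zero => intro; rfl
  | succ j ih =>
    intro hj
    rw [List.range_succ, List.foldl_append, List.foldl_cons, List.foldl_nil, ← ih (Nat.le_of_succ_le hj), lettersLoop]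
    simp only [wArr_getD]
    by_cases hw : P.wOf j ≤ B
    · rw [if_pos hw, if_pos hw]
      have hjL : j < P.nL := hj
      have hso : (s.op P.Amax P.Cc).Valid P.Amax P.C P.Cc := valid_op hs
      have hsc : (s.cl P.C).Valid P.Amax P.C P.Cc := valid_cl hs
      have hr1 : P.InRange NB (s.op P.Amax P.Cc) b j (B - P.wOf j) :=
        ⟨hso.1, hso.2.1, hso.2.2.1, hso.2.2.2, hb, hjL, by omega⟩
      have hr2 : P.InRange NB (s.cl P.C) b j (B - P.wOf j) :=
        ⟨hsc.1, hsc.2.1, hsc.2.2.1, hsc.2.2.2, hb, hjL, by omega⟩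
      have e1 : P.lookup NB arr (s.op P.Amax P.Cc) b j (B - P.wOf j) =
          (arr[(j + (b + P.sIdx (s.op P.Amax P.Cc) * P.nL) * P.nL) * (NB + 1) + (B - P.wOf j)]?).getD none := by
        rw [GameSpec.lookup, if_pos hr1, GameSpec.eIdx]; congr 2; ring
      have e2 : P.lookup NB arr (s.cl P.C) b j (B - P.wOf j) =
          (arr[(j + (b + P.sIdx (s.cl P.C) * P.nL) * P.nL) * (NB + 1) + (B - P.wOf j)]?).getD none := by
        rw [GameSpec.lookup, if_pos hr2, GameSpec.eIdx]; congr 2; ring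
      rw [e1, e2]
    · rw [if_neg hw, if_neg hw]

/-- Bounds on a decoded row index. [this work] -/
theorem decode_bounds {NB i : ℕ} (hi : i < P.tSize NB) :
    i / (NB + 1) < P.nS * P.nL * P.nL ∧
    i / (NB + 1) % P.nL < P.nL ∧ i / (NB + 1) / P.nL % P.nL < P.nL ∧
    i / (NB + 1) / P.nL / P.nL / (P.Cc + 1) / (P.C + 1) / (P.C + 1) ≤ P.Amax := by
  have h1 : i / (NB + 1) < P.nS * P.nL * P.nL :=
    Nat.div_lt_of_lt_mul (by rw [GameSpec.tSize] at hi; linarith [hi])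
  have hL : 0 < P.nL := by
    rcases Nat.eq_zero_or_pos P.nL with h0 | h0
    · rw [h0] at h1; simp at h1
    · exact h0
  refine ⟨h1, Nat.mod_lt _ hL, Nat.mod_lt _ hL, ?_⟩
  have h2 : i / (NB + 1) / P.nL < P.nS * P.nL := Nat.div_lt_of_lt_mul (by rw [Nat.mul_comm]; linarith [h1])
  have h3 : i / (NB + 1) / P.nL / P.nL < P.nS := Nat.div_lt_of_lt_mul (by rw [Nat.mul_comm]; exact h2)
  rw [GameSpec.nS] at h3
  have h4 : i / (NB + 1) / P.nL / P.nL / (P.Cc + 1) < (P.Amax + 1) * (P.C + 1) * (P.C + 1) :=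
    Nat.div_lt_of_lt_mul (by rw [Nat.mul_comm]; exact h3)
  have h5 : i / (NB + 1) / P.nL / P.nL / (P.Cc + 1) / (P.C + 1) < (P.Amax + 1) * (P.C + 1) :=
    Nat.div_lt_of_lt_mul (by rw [Nat.mul_comm]; exact h4)
  have h6 : i / (NB + 1) / P.nL / P.nL / (P.Cc + 1) / (P.C + 1) / (P.C + 1) < P.Amax + 1 :=
    Nat.div_lt_of_lt_mul (by rw [Nat.mul_comm]; exact h5)
  omega

/-- **One fast layer is one reference Bellman step** (on a previous layer confined to its window). [this work] -/
theorem fastLayer_eq {NB m : ℕ} (arr : Array (Option ℤ))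
    (hprev : ∀ (s : FSt) (a b B : ℕ), (P.lookup NB arr s a b B).isSome → m * P.wmin ≤ B ∧ B ≤ m * P.wmax) :
    P.fastLayer NB (m + 1) P.wArr P.nL P.wmin P.wmax arr = P.tabulate NB (P.stepVal (P.lookup NB arr)) := by
  apply Array.ext
  · simp [GameSpec.fastLayer, GameSpec.tabulate]
  intro i hi₁ hi₂
  have hi : i < P.tSize NB := by simpa [GameSpec.tabulate] using hi₂
  obtain ⟨hr, hbL, haL, hA⟩ := P.decode_bounds hi
  simp only [GameSpec.fastLayer, GameSpec.tabulate, Array.getElem_ofFn, Array.getElem?_ofFn, dif_pos hr, Option.getD_some,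
    GameSpec.fastRow, GameSpec.dIdx]
  rw [dif_pos (Nat.mod_lt _ (Nat.succ_pos NB)), Option.getD_some]
  -- the decoded state is valid, the pending letters and the budget are in range
  set r := i / (NB + 1) with hrdef
  set B := i % (NB + 1) with hBdef
  have hBNB : B ≤ NB := Nat.lt_succ_iff.1 (Nat.mod_lt _ (Nat.succ_pos NB))
  set s : FSt := ⟨r / P.nL / P.nL / (P.Cc + 1) / (P.C + 1) / (P.C + 1), r / P.nL / P.nL / (P.Cc + 1) / (P.C + 1) % (P.C + 1),
    r / P.nL / P.nL / (P.Cc + 1) % (P.C + 1), r / P.nL / P.nL % (P.Cc + 1)⟩ with hsdef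
  have hs : s.Valid P.Amax P.C P.Cc :=
    ⟨hA, Nat.lt_succ_iff.1 (Nat.mod_lt _ (Nat.succ_pos _)), Nat.lt_succ_iff.1 (Nat.mod_lt _ (Nat.succ_pos _)),
      Nat.lt_succ_iff.1 (Nat.mod_lt _ (Nat.succ_pos _))⟩
  by_cases hwin : B < (m + 1) * P.wmin ∨ (m + 1) * P.wmax < B
  · rw [if_pos hwin, P.stepVal_eq_none hprev _ _ _ hwin]
  · rw [if_neg hwin, P.lettersLoop_eq NB arr hs hbL hBNB P.nL le_rfl, stepVal_eq]

/-- **The fast table is the reference table** (for a base layer vanishing off budget `0`). [this work] -/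
theorem fastArr_eq {base : FSt → ℕ → ℕ → ℕ → Option ℤ} (hbase : ∀ s a b B, (base s a b B).isSome → B = 0) (NB : ℕ) :
    ∀ n, P.fastArr base NB n = P.gameIter NB n (P.tabulate NB base) := by
  intro n
  induction n with
  | zero => rfl
  | succ m ih =>
    rw [GameSpec.fastArr, ih, gameIter_succ]
    exact P.fastLayer_eq _ (P.isSome_lookup_gameIter hbase NB m)

/-- The base layer vanishes off budget `0`. [this work] -/
theorem baseVal_isSome {s : FSt} {a b B : ℕ} (h : (P.baseVal s a b B).isSome) : B = 0 := by
  unfold baseVal at h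
  by_contra hB
  rw [if_neg hB] at h
  simp at h

/-- The λ-refined base layer vanishes off budget `0`. [this work] -/
theorem baseValL_isSome {lamN lamD : ℕ} {s : FSt} {a b B : ℕ} (h : (P.baseValL lamN lamD s a b B).isSome) : B = 0 := by
  unfold baseValL at h
  by_contra hB
  rw [if_neg hB] at h
  simp at h

/-- `gameArrF = gameArr`. [this work] -/
theorem gameArrF_eq (NB n : ℕ) : P.gameArrF NB n = P.gameArr NB n :=
  P.fastArr_eq (fun _ _ _ _ h => P.baseVal_isSome h) NB n

/-- `gameArrLF = gameArrL`. [this work] -/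
theorem gameArrLF_eq (lamN lamD NB n : ℕ) : P.gameArrLF lamN lamD NB n = P.gameArrL lamN lamD NB n :=
  P.fastArr_eq (fun _ _ _ _ h => P.baseValL_isSome h) NB n

/-- **`gameCertF = gameCert`.** [this work] -/
theorem gameCertF_eq (NB K : ℕ) (Bs : List ℕ) : P.gameCertF NB K Bs = P.gameCert NB K Bs :=
  -- (a single term, so that the proof does not depend on whether the `match` auxiliaries of the two sides are shared)
  (congrArg (fun T => Bs.all fun B => match P.startOf NB T B with
      | some v => decide (0 ≤ v)
      | none => true) (P.gameArrF_eq NB (K - 2)) : _)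

/-- **`gameCertTF = gameCertT`.** [this work] -/
theorem gameCertTF_eq (lamN lamD NB K : ℕ) (Bt : List (ℕ × ℤ)) :
    P.gameCertTF lamN lamD NB K Bt = P.gameCertT lamN lamD NB K Bt :=
  -- (a single term, so that the proof does not depend on whether the `match` auxiliaries of the two sides are shared)
  (congrArg (fun T => Bt.all fun bt => match P.startOf NB T bt.1 with
      | some v => decide (bt.2 ≤ v)
      | none => true) (P.gameArrLF_eq lamN lamD NB (K - 2)) : _)

end GameSpec

end Summit.CriticalPhenomena.PercolationContinuityZ3.Theorems.HairyCycle
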